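import Summits.NavierStokesRegularity.NavierStokesRegularity.Theorems.ClockStretchingLawClockCeilingOpenSetVorticityLiouville
import Summits.NavierStokesRegularity.NavierStokesRegularity.Theorems.RellichScarScarRigiditySelfSimilarOfGeneratorZero
import Summits.NavierStokesRegularity.NavierStokesRegularity.Theorems.PoloidalWindowDoorPoloidalWindowRigidityStrata
import HarnessLib

/-!
# Crux `FiniteDissipationLiouville` (stmt-NavierStokesRegularity-22144): LOCAL SELF-SIMILARITY
# KILLS — the scaling generator of a nonzero Type-I ancient mild field vanishes on no open
# subset of the past

Theorems file of route `LerayQuarterDissipation` (lead prover g13; `--supports` the crux;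
companion of `…ReturnTimes` / `…ReturnTimesSharp`, the `σ → 0` end of the return-time portrait).
Navier–Stokes regularity is NOT proved by anything here; no summit is. No dissipation law is used:
the statements hold on the whole Type-I ancient mild class (KNSS gauge).

* `analyticOnNhd_scalingGenerator` — the scaling generator, written invariantly as
  `z ↦ W z + D(uncurry W)(z)(2 z.1, z.2)`, is jointly real-analytic on the open slab
  `(−∞,0) × ℝ³` (the Fréchet derivative of the jointly analytic `uncurry W` —
  `openSetLiouville_analyticOnNhd_uncurry`, Lemarié-Rieusset 2016 Thm 9.12 — is analytic;
  evaluation along the linear field `z ↦ (2 z.1, z.2)` is a continuous bilinear operation).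
* `scalingGenerator_eq` — on the slab it equals `W + x·∇ₓW + 2t ∂ₜW` (split of the joint
  derivative into its partials, `IsSmoothSpaceTimeOn.deriv_timeLine` /
  `fderiv_slice_apply_of_isOpen`), i.e. `d/dσ|₀ W_{e^σ}` — minus twice the Pineau–Vicol quantity
  `(−t)∂ₜW − ½W − ½x·∇W` of the route's unsteadiness floor.
* `eq_zero_of_scalingGenerator_eq_zero_nhds` — **LOCAL SELF-SIMILARITY KILLS A CLASS MEMBER**:
  if the generator vanishes on a neighbourhood of ONE point of the open past then `W ≡ 0` on the
  past (identity theorem on the preconnected slab; a vanishing generator makes `W` exactly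
  self-similar on the past — the sister line's proved
  `RellichScarScarRigidity.stub_selfSimilar_of_scalingGeneratorZero`; self-similar members vanish,
  `PoloidalWindowDoorPoloidalWindowRigidityStrata.eq_zero_of_scaleInvariant`, Tsai 1998).
  `not_singular_of_scalingGenerator_eq_zero_nhds`: regularity form for the portrait. This is the
  qualitative, every-point, law-free companion of the Pineau–Vicol floor (`…EnvelopePV`:
  quantitative, on `B(0,1)` at late times, for the critical element) and the `σ → 0` end of the
  displacement floor `sup_window ‖W_{e^σ} − W‖ > κσ` of `…ReturnTimesSharp`; the sibling of the
  tree's `openSetSteadyLiouville` (`∂ₜu = 0` on an open set ⇒ `u ≡ 0`).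

HONEST FRAMING: a portrait fact; the crux stays blocked on `∀ c > 1, TypeIDSSLiouville c`.
Not done (census): the ONE-SLICE form (generator of one slice vanishing on an open set of `ℝ³` ⇒
`W ≡ 0`, the analogue of `SteadySliceLiouville`) needs the self-similar continuation of the slice
to be a KNSS-mild class member.

References: Tsai, ARMA 143 (1998), Thm 1; Lemarié-Rieusset (2016), Thm 9.12; Pineau–Vicol 2026.
-/

noncomputable section

-- the summit and its single sub-problem share the name (CONVENTIONS §1), as in every Theorems file
set_option linter.dupNamespace false

namespace Summit.NavierStokesRegularity.NavierStokesRegularity.Theorems.FiniteDissipationLiouville.ReturnTimes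

open MeasureTheory Set Filter Topology Metric Function
open Literature.Analysis Literature.Analysis.FluidPDE
open scoped ENNReal NNReal

/-! ### Local self-similarity: the scaling generator of a nonzero member vanishes on no open set -/

/-- **The scaling generator is jointly real-analytic on the open slab.** For a class member `W`,
`z ↦ W z + D(uncurry W)(z)(2 z.1, z.2)` — which on the slab equals
`W + x·∇ₓW + 2t ∂ₜW` (`scalingGenerator_eq`) — is real-analytic on `(−∞,0) × ℝ³` (the Fréchet
derivative of the jointly analytic `uncurry W` is analytic; evaluation along the linear field
`z ↦ (2 z.1, z.2)`). [cite: LemarieRieusset2016, Thm. 9.12 (PDF p. 260)] -/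
theorem analyticOnNhd_scalingGenerator {C : ℝ}
    {W : ℝ → EuclideanSpace ℝ (Fin 3) → EuclideanSpace ℝ (Fin 3)} (hW : IsTypeIAncientMild C W) :
    AnalyticOnNhd ℝ (fun z : ℝ × EuclideanSpace ℝ (Fin 3) =>
        W z.1 z.2 + fderiv ℝ (uncurry W) z ((2 * z.1, z.2) : ℝ × EuclideanSpace ℝ (Fin 3)))
      (Iio (0 : ℝ) ×ˢ (univ : Set (EuclideanSpace ℝ (Fin 3)))) := by
  have han := openSetLiouville_analyticOnNhd_uncurry hW
  -- the linear field `z ↦ (2 z.1, z.2)`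
  set L : ℝ × EuclideanSpace ℝ (Fin 3) →L[ℝ] ℝ × EuclideanSpace ℝ (Fin 3) :=
    ((2 : ℝ) • ContinuousLinearMap.fst ℝ ℝ (EuclideanSpace ℝ (Fin 3))).prod
      (ContinuousLinearMap.snd ℝ ℝ (EuclideanSpace ℝ (Fin 3))) with hLdef
  have hLapply : ∀ z : ℝ × EuclideanSpace ℝ (Fin 3),
      L z = ((2 * z.1, z.2) : ℝ × EuclideanSpace ℝ (Fin 3)) := fun z => by
    simp [hLdef]
  -- evaluation `(A, v) ↦ A v` is a continuous bilinear map, hence analytic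
  have hev : ∀ q : (ℝ × EuclideanSpace ℝ (Fin 3) →L[ℝ] EuclideanSpace ℝ (Fin 3)) ×
      (ℝ × EuclideanSpace ℝ (Fin 3)),
      AnalyticAt ℝ (fun q : (ℝ × EuclideanSpace ℝ (Fin 3) →L[ℝ] EuclideanSpace ℝ (Fin 3)) ×
        (ℝ × EuclideanSpace ℝ (Fin 3)) => q.1 q.2) q := fun q =>
    (ContinuousLinearMap.id ℝ
      (ℝ × EuclideanSpace ℝ (Fin 3) →L[ℝ] EuclideanSpace ℝ (Fin 3))).analyticAt_bilinear q
  have hD : AnalyticOnNhd ℝ (fun z : ℝ × EuclideanSpace ℝ (Fin 3) =>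
      fderiv ℝ (uncurry W) z ((2 * z.1, z.2) : ℝ × EuclideanSpace ℝ (Fin 3)))
      (Iio (0 : ℝ) ×ˢ univ) := by
    intro z hz
    have h := (hev (fderiv ℝ (uncurry W) z, L z)).comp₂ (han.fderiv z hz) (L.analyticAt z)
    refine h.congr (Filter.Eventually.of_forall fun y => ?_)
    simp only [hLapply]
  exact han.add hD

/-- On the slab the analytic generator is the scaling generator `W + x·∇ₓW + 2t ∂ₜW` written with
the slice derivative and the time derivative (split of the joint derivative into its partials). -/
theorem scalingGenerator_eq {C : ℝ}
    {W : ℝ → EuclideanSpace ℝ (Fin 3) → EuclideanSpace ℝ (Fin 3)} (hW : IsTypeIAncientMild C W)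
    {t : ℝ} (ht : t < 0) (x : EuclideanSpace ℝ (Fin 3)) :
    W t x + fderiv ℝ (uncurry W) (t, x) ((2 * t, x) : ℝ × EuclideanSpace ℝ (Fin 3)) =
      W t x + fderiv ℝ (W t) x x + (2 * t) • deriv (fun s => W s x) t := by
  have hsm : IsSmoothSpaceTimeOn (Iio (0 : ℝ)) W := hW.contDiffOn
  have hvec : ((2 * t, x) : ℝ × EuclideanSpace ℝ (Fin 3)) =
      (2 * t) • ((1, 0) : ℝ × EuclideanSpace ℝ (Fin 3)) + ((0, x) : ℝ × EuclideanSpace ℝ (Fin 3)) := by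
    ext <;> simp
  rw [hvec, map_add, map_smul, ← hsm.deriv_timeLine isOpen_Iio ht x,
    ← hsm.fderiv_slice_apply_of_isOpen isOpen_Iio ht x x]
  abel

/-- **LOCAL SELF-SIMILARITY KILLS A CLASS MEMBER (open-set form).** If the scaling generator
`W + x·∇ₓW + 2t ∂ₜW` of a Type-I ancient mild field (KNSS gauge) vanishes on a neighbourhood of
ONE point of the open past, then `W ≡ 0` on the past: the generator is real-analytic on the
preconnected slab, so it vanishes identically; a vanishing generator makes `W` exactly
self-similar on the past (`RellichScarScarRigidity.stub_selfSimilar_of_scalingGeneratorZero`),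
and self-similar members vanish (`eq_zero_of_scaleInvariant`, Tsai 1998). No dissipation law is
needed. [cite: Tsai1998, Thm. 1] -/
theorem eq_zero_of_scalingGenerator_eq_zero_nhds {C : ℝ}
    {W : ℝ → EuclideanSpace ℝ (Fin 3) → EuclideanSpace ℝ (Fin 3)} (hW : IsTypeIAncientMild C W)
    {p : ℝ × EuclideanSpace ℝ (Fin 3)} (hp : p.1 < 0)
    (h : ∀ᶠ z in 𝓝 p,
      W z.1 z.2 + fderiv ℝ (W z.1) z.2 z.2 + (2 * z.1) • deriv (fun s => W s z.2) z.1 = 0) :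
    ∀ t < 0, ∀ x, W t x = 0 := by
  have hU : IsPreconnected (Iio (0 : ℝ) ×ˢ (univ : Set (EuclideanSpace ℝ (Fin 3)))) :=
    ((convex_Iio (0 : ℝ)).prod convex_univ).isPreconnected
  have hG := analyticOnNhd_scalingGenerator hW
  -- the analytic generator vanishes near `p`, hence on the slab
  have hev : (fun z : ℝ × EuclideanSpace ℝ (Fin 3) =>
      W z.1 z.2 + fderiv ℝ (uncurry W) z ((2 * z.1, z.2) : ℝ × EuclideanSpace ℝ (Fin 3)))
        =ᶠ[𝓝 p] 0 := by
    have hslab : Iio (0 : ℝ) ×ˢ (univ : Set (EuclideanSpace ℝ (Fin 3))) ∈ 𝓝 p :=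
      (isOpen_Iio.prod isOpen_univ).mem_nhds ⟨hp, mem_univ _⟩
    filter_upwards [h, hslab] with z hz hzs
    obtain ⟨t, x⟩ := z
    have ht : t < 0 := hzs.1
    rw [Pi.zero_apply, scalingGenerator_eq hW ht x]
    exact hz
  have hzero := hG.eqOn_zero_of_preconnected_of_eventuallyEq_zero hU ⟨hp, mem_univ _⟩ hev
  have hgen : ∀ t < 0, ∀ x : EuclideanSpace ℝ (Fin 3),
      W t x + fderiv ℝ (W t) x x + (2 * t) • deriv (fun s => W s x) t = 0 := by
    intro t ht x
    rw [← scalingGenerator_eq hW ht x]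
    exact hzero (mk_mem_prod ht (mem_univ x))
  -- vanishing generator ⇒ self-similar on the past ⇒ zero
  have hss := RellichScarScarRigidity.stub_selfSimilar_of_scalingGeneratorZero W C hW hgen
  exact PoloidalWindowDoorPoloidalWindowRigidityStrata.eq_zero_of_scaleInvariant
    hW.hasTypeITimeDecay hW.continuousOn_uncurry
    (fun _ _ hst ht x => hW.mild_eq_heatExtension hst ht x) (fun t ht => hW.isDivFree ht)
    (fun lam hlam s hs y => by
      have e := hss lam hlam s hs y
      rwa [nsRescale_apply] at e)

/-- **Not singular form** (for the portrait): a member whose scaling generator vanishes near one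
point of the open past is not singular at the apex. -/
theorem not_singular_of_scalingGenerator_eq_zero_nhds {C : ℝ}
    {W : ℝ → EuclideanSpace ℝ (Fin 3) → EuclideanSpace ℝ (Fin 3)} (hW : IsTypeIAncientMild C W)
    {p : ℝ × EuclideanSpace ℝ (Fin 3)} (hp : p.1 < 0)
    (h : ∀ᶠ z in 𝓝 p,
      W z.1 z.2 + fderiv ℝ (W z.1) z.2 z.2 + (2 * z.1) • deriv (fun s => W s z.2) z.1 = 0) :
    ¬ (∀ r > 0, ∀ M : ℝ, ∃ t ∈ Set.Ioo (-(r ^ 2)) (0 : ℝ),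
        ∃ x ∈ Metric.ball (0 : EuclideanSpace ℝ (Fin 3)) r, M < ‖W t x‖) := by
  intro hsing
  obtain ⟨t, ht, x, -, hM⟩ := hsing 1 one_pos 0
  rw [eq_zero_of_scalingGenerator_eq_zero_nhds hW hp h t ht.2 x, norm_zero] at hM
  exact lt_irrefl _ hM

end Summit.NavierStokesRegularity.NavierStokesRegularity.Theorems.FiniteDissipationLiouville.ReturnTimes

end
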